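import Mathlib

/-!
# Route «KPlusLogSqLaw» — parametric max-weight independent set on a path: THE GAP-CHARGING LEMMA (events ≤ n + 2 · record changes)

HONEST FRAMING.  Helper toward the crux `WeakLifting` (item `stmt-ValiantsHypothesis-19561`, route `KPlusLogSqLaw`, cell `pub-symmetroid`,
seat val-sym-lift-p4 g24, 2026-08-29) on the line of its witness-plan stub `stub_tridiagonalSectorB` (tropical twin of the STATIC tridiagonal
sector = parametric maximum-weight independent set on a path; located theory `HOME/val-sym-lift-p4/SILENT-FLIP-LAW.md`, val-sym-lift-p4 g23).
This file is the ABSTRACT COUNTING CORE of the silent-flip law, in its one-for-two form (memo §3, Claim 1 and parts (i)–(ii) of Claim 2),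
stated for an arbitrary set-valued process and therefore Mathlib-only:

* data: record sets `N k ⊆ ℕ` at the steps `k = 0, 1, …`, a pair of labels `x k < y k ≤ n` acted on at step `k`, and a finite set `Ev` of
  EVENT steps `k < T`;
* hypotheses: at an event step both labels are records and no label strictly between them is (`hEv`), the record set does not change across an
  event step (`hN`), and a pair of labels is an event at most once (`hinj`);
* conclusion (`card_events_le_add_two_mul_card_changes`): `#Ev ≤ n + 2 · #{(k, z) : k < T, z ≤ n, z ∈ N k ↮ z ∈ N (k+1)}`.

Mechanism: the LAST event of each left end `x` is paid by the label `x < n` (`card_lastEvents_le`); a non-last event `(u, v)` at step `t` is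
charged to the FIRST later step at which some label of the closed gap `[u, v]` changes its record membership — it exists and precedes the
next event of `u` (`exists_change_between`: the next partner differs, so the minimum of the records above `u` moved), and until it the gap is
FROZEN (`frozen_of_min`); two events charged to the same change `(s, z)` have distinct left ends unless equal (`eq_of_charge_eq_of_left_eq`)
and cannot have left ends `u < u' < z` (`false_of_charge_eq_of_lt`: `u'` would be a non-record throughout the frozen window of `(u, v)` yet a
record at its own, earlier, event and frozen so until `s`), so every change is charged at most twice.  The sharp one-for-one law of the memo
(a change is charged at most ONCE) needs the heights and the chain semantics and is not in this file.  The instantiation to sweeps of the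
prefix-sum arrangement (records = touch points of the two alternating folds) is the sequel.  Pure finite combinatorics; nothing here asserts
anything about `WeakLifting`, `TropicalB`, `KPlusLogSqLaw`, the stub in its window, `MatrixDescartes` (stmt-ValiantsHypothesis-18050) or
`VP ≠ VNP`; the ORDER QUESTION stays open.
-/

set_option linter.dupNamespace false
set_option autoImplicit false

namespace Summit.ValiantsHypothesis.ValiantsHypothesis.Theorems.KPlusLogSqLaw

open Finset Classical

namespace StaticPathFold

/-! ## 1. Two elementary search lemmas -/

/-- if a predicate differs at two times `t ≤ t'`, it changes across some unit step in between. [folklore] -/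
theorem exists_step_of_not_iff {P : ℕ → Prop} {t t' : ℕ} (htt' : t ≤ t') (h : ¬ (P t ↔ P t')) :
    ∃ s, t ≤ s ∧ s < t' ∧ ¬ (P s ↔ P (s + 1)) := by
  induction t' with
  | zero =>
    have ht : t = 0 := by omega
    subst ht
    exact absurd Iff.rfl h
  | succ m ih =>
    rcases Nat.lt_or_ge t (m + 1) with h1 | h1
    · by_cases hm : (P t ↔ P m)
      · exact ⟨m, by omega, by omega, fun h2 => h (hm.trans h2)⟩
      · obtain ⟨s, hs1, hs2, hs3⟩ := ih (by omega) hm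
        exact ⟨s, hs1, by omega, hs3⟩
    · have ht : t = m + 1 := by omega
      subst ht
      exact absurd Iff.rfl h

/-- the first time after `t` at which a property holds. [folklore] -/
theorem exists_min_after {Q : ℕ → Prop} {t : ℕ} (h : ∃ s, t < s ∧ Q s) :
    ∃ s, t < s ∧ Q s ∧ ∀ r, t < r → r < s → ¬ Q r := by
  refine ⟨Nat.find h, (Nat.find_spec h).1, (Nat.find_spec h).2, fun r hr1 hr2 hQ => ?_⟩
  exact Nat.find_min h hr2 ⟨hr1, hQ⟩

/-! ## 2. The gap-charging lemma -/

section GapCharging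

variable {n T : ℕ} {N : ℕ → Finset ℕ} {x y : ℕ → ℕ} {Ev : Finset ℕ}

/-- **Claim 1.**  If `t < t'` are events with the same left end, then some label of the closed gap `[x t, y t]` changes its record
membership across a step `s` with `t < s < t'`: the two partners differ (a pair is an event once), so the least record above the left end
moved between `t` and `t'`, and the record set does not move at the event step `t` itself. [folklore] -/
theorem exists_change_between
    (hEv : ∀ k ∈ Ev, k < T ∧ x k < y k ∧ y k ≤ n ∧ x k ∈ N k ∧ y k ∈ N k ∧ ∀ z, x k < z → z < y k → z ∉ N k)
    (hN : ∀ k ∈ Ev, N (k + 1) = N k)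
    (hinj : ∀ k ∈ Ev, ∀ k' ∈ Ev, x k = x k' → y k = y k' → k = k')
    {t t' : ℕ} (ht : t ∈ Ev) (ht' : t' ∈ Ev) (htt' : t < t') (hxx : x t' = x t) :
    ∃ s, t < s ∧ s < t' ∧ ∃ z, x t ≤ z ∧ z ≤ y t ∧ ¬ (z ∈ N s ↔ z ∈ N (s + 1)) := by
  obtain ⟨-, hxy, -, -, hyN, hgap⟩ := hEv t ht
  obtain ⟨-, hxy', -, -, hyN', hgap'⟩ := hEv t' ht'
  have hne : y t ≠ y t' := fun h => absurd (hinj t ht t' ht' hxx.symm h) (by omega)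
  -- a label `z ∈ (x t, y t]` whose membership differs at `t` and at `t'`
  obtain ⟨z, hz1, hz2, hz3⟩ : ∃ z, x t < z ∧ z ≤ y t ∧ ¬ (z ∈ N t ↔ z ∈ N t') := by
    rcases lt_or_gt_of_ne hne with h | h
    · -- `y t < y t'`: the old partner lies in the open gap of the second event
      exact ⟨y t, hxy, le_rfl, fun hiff => hgap' (y t) (by omega) h (hiff.mp hyN)⟩
    · -- `y t' < y t`: the new partner lies in the open gap of the first event
      exact ⟨y t', by omega, h.le, fun hiff => hgap (y t') (by omega) h (hiff.mpr hyN')⟩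
  obtain ⟨s, hs1, hs2, hs3⟩ := exists_step_of_not_iff (P := fun τ => z ∈ N τ) htt'.le hz3
  have hst : s ≠ t := by
    intro hst
    rw [hst] at hs3
    exact hs3 (by rw [hN t ht])
  exact ⟨s, by omega, hs2, z, hz1.le, hz2, hs3⟩

/-- **the frozen window**: if the record set does not move at step `t` and no label of `[x t, y t]` changes at the steps strictly between
`t` and `s`, then every label of `[x t, y t]` has, at every time of `[t, s]`, its membership of time `t`. [folklore] -/
theorem frozen_of_min {t s : ℕ} (hNt : N (t + 1) = N t)
    (hmin : ∀ r, t < r → r < s → ∀ w, x t ≤ w → w ≤ y t → (w ∈ N r ↔ w ∈ N (r + 1))) :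
    ∀ τ, t ≤ τ → τ ≤ s → ∀ w, x t ≤ w → w ≤ y t → (w ∈ N τ ↔ w ∈ N t) := by
  intro τ
  induction τ with
  | zero =>
    intro h1 _ w _ _
    have ht : t = 0 := by omega
    subst ht
    exact Iff.rfl
  | succ m ih =>
    intro h1 h2 w hw1 hw2
    rcases Nat.lt_or_ge m t with h | h
    · have ht : t = m + 1 := by omega
      rw [ht]
    · have ihm := ih h (by omega) w hw1 hw2
      rcases eq_or_lt_of_le h with h3 | h3
      · subst h3
        rw [hNt]
      · rw [← ihm]
        exact (hmin m h3 (by omega) w hw1 hw2).symm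

/-- **THE GAP-CHARGING LEMMA** (silent-flip law, one-for-two form; `HOME/val-sym-lift-p4/SILENT-FLIP-LAW.md` §3 (i)–(ii)).  For a set
process `N` with acted pairs `x k < y k ≤ n` and event steps `Ev` (both labels records, no record strictly between, records unchanged across the
step, each pair an event at most once): the number of events is at most `n` plus twice the number of pairs `(k, z)`, `k < T`, `z ≤ n`, at which
label `z` changes its record membership. [folklore] -/
theorem card_events_le_add_two_mul_card_changes
    (hEv : ∀ k ∈ Ev, k < T ∧ x k < y k ∧ y k ≤ n ∧ x k ∈ N k ∧ y k ∈ N k ∧ ∀ z, x k < z → z < y k → z ∉ N k)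
    (hN : ∀ k ∈ Ev, N (k + 1) = N k)
    (hinj : ∀ k ∈ Ev, ∀ k' ∈ Ev, x k = x k' → y k = y k' → k = k') :
    Ev.card ≤ n + 2 * (((range T) ×ˢ (range (n + 1))).filter
      (fun kz : ℕ × ℕ => ¬ (kz.2 ∈ N kz.1 ↔ kz.2 ∈ N (kz.1 + 1)))).card := by
  set M := ((range T) ×ˢ (range (n + 1))).filter
      (fun kz : ℕ × ℕ => ¬ (kz.2 ∈ N kz.1 ↔ kz.2 ∈ N (kz.1 + 1))) with hM
  -- non-last and last events of each left end
  set P := Ev.filter (fun t => ∃ t' ∈ Ev, t < t' ∧ x t' = x t) with hP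
  set Lst := Ev.filter (fun t => ¬ ∃ t' ∈ Ev, t < t' ∧ x t' = x t) with hLst
  have hsplit : P.card + Lst.card = Ev.card := Finset.card_filter_add_card_filter_not _
  -- (1) last events: one per left end, and left ends are `< n`
  have hLst_le : Lst.card ≤ n := by
    have h : Lst.card ≤ (range n).card := by
      refine Finset.card_le_card_of_injOn x (fun t ht => ?_) (fun t ht t' ht' hx => ?_)
      · obtain ⟨htE, -⟩ := mem_filter.mp ht
        obtain ⟨-, hxy, hyn, -⟩ := hEv t htE
        exact mem_coe.mpr (mem_range.mpr (by omega))
      · obtain ⟨htE, hno⟩ := mem_filter.mp (mem_coe.mp ht)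
        obtain ⟨ht'E, hno'⟩ := mem_filter.mp (mem_coe.mp ht')
        by_contra hne
        rcases lt_or_gt_of_ne hne with hlt | hlt
        · exact hno ⟨t', ht'E, hlt, hx.symm⟩
        · exact hno' ⟨t, htE, hlt, hx⟩
    simpa using h
  -- (2) the charge of a non-last event: the first later step at which a label of its closed gap changes
  have hex : ∀ t ∈ P, ∃ s, t < s ∧ (∃ z, x t ≤ z ∧ z ≤ y t ∧ ¬ (z ∈ N s ↔ z ∈ N (s + 1))) ∧
      ∀ r, t < r → r < s → ¬ ∃ z, x t ≤ z ∧ z ≤ y t ∧ ¬ (z ∈ N r ↔ z ∈ N (r + 1)) := by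
    intro t ht
    obtain ⟨htE, t', ht'E, htt', hxx⟩ := mem_filter.mp ht
    obtain ⟨s, hs1, -, hz⟩ := exists_change_between hEv hN hinj htE ht'E htt' hxx
    exact exists_min_after ⟨s, hs1, hz⟩
  choose! σ hσ1 hσz hσmin using hex
  choose! ζ hζ1 hζ2 hζ3 using hσz
  -- minimality in usable form, the frozen window, and «the charge precedes the next event of the same left end»
  have hmin : ∀ t ∈ P, ∀ r, t < r → r < σ t → ∀ w, x t ≤ w → w ≤ y t → (w ∈ N r ↔ w ∈ N (r + 1)) := by
    intro t ht r hr1 hr2 w hw1 hw2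
    by_contra h
    exact hσmin t ht r hr1 hr2 ⟨w, hw1, hw2, h⟩
  have hfrozen : ∀ t ∈ P, ∀ τ, t ≤ τ → τ ≤ σ t → ∀ w, x t ≤ w → w ≤ y t → (w ∈ N τ ↔ w ∈ N t) :=
    fun t ht => frozen_of_min (hN t (mem_filter.mp ht).1) (hmin t ht)
  have hnext : ∀ t ∈ P, ∀ t' ∈ Ev, t < t' → x t' = x t → σ t < t' := by
    intro t ht t' ht'E htt' hxx
    obtain ⟨s, hs1, hs2, z, hz1, hz2, hz3⟩ := exists_change_between hEv hN hinj (mem_filter.mp ht).1 ht'E htt' hxx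
    by_contra h
    exact hz3 (hmin t ht s hs1 (by omega) z hz1 hz2)
  -- the charge lands in `M`
  have hmaps : ∀ t ∈ P, (σ t, ζ t) ∈ M := by
    intro t ht
    obtain ⟨htE, t', ht'E, htt', hxx⟩ := mem_filter.mp ht
    have h1 := hnext t ht t' ht'E htt' hxx
    have h2 := (hEv t' ht'E).1
    have h3 := (hEv t htE).2.2.1
    rw [hM, mem_filter, mem_product, mem_range, mem_range]
    exact ⟨⟨by omega, by have := hζ2 t ht; omega⟩, hζ3 t ht⟩
  -- (i) two charged events with the same left end and the same charge coincide
  have hsame : ∀ t ∈ P, ∀ t' ∈ P, x t = x t' → σ t = σ t' → t = t' := by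
    intro t ht t' ht' hx hs
    by_contra hne
    rcases lt_or_gt_of_ne hne with hlt | hlt
    · have h1 := hnext t ht t' (mem_filter.mp ht').1 hlt hx.symm
      have h2 := hσ1 t' ht'
      omega
    · have h1 := hnext t' ht' t (mem_filter.mp ht).1 hlt hx
      have h2 := hσ1 t ht
      omega
  -- (ii) no two charged events with left ends `x t < x t' < ζ` and the same charge
  have hlt_false : ∀ t ∈ P, ∀ t' ∈ P, x t < x t' → x t' < ζ t → σ t = σ t' → ζ t = ζ t' → False := by
    intro t ht t' ht' hxx hxz hs hz
    obtain ⟨htE, -⟩ := mem_filter.mp ht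
    obtain ⟨ht'E, -⟩ := mem_filter.mp ht'
    obtain ⟨-, -, -, -, -, hgap⟩ := hEv t htE
    obtain ⟨-, -, -, hxN', -, -⟩ := hEv t' ht'E
    -- `x t'` lies in the open gap of the event `t`, hence is a non-record on the frozen window `[t, σ t]`
    have hz_le : ζ t ≤ y t := hζ2 t ht
    have hout : ∀ τ, t ≤ τ → τ ≤ σ t → x t' ∉ N τ := fun τ h1 h2 hmem =>
      hgap (x t') hxx (by omega) ((hfrozen t ht τ h1 h2 (x t') hxx.le (by omega)).mp hmem)
    -- but it is a record at its own event step `t' < σ t' = σ t`, so `t' < t` …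
    have h1 : t' < σ t' := hσ1 t' ht'
    have h0 : t < σ t := hσ1 t ht
    have ht't : t' < t := by
      by_contra h
      exact hout t' (by omega) (by omega) hxN'
    -- … and then frozen as a record on `[t', σ t']`, in particular at time `t`
    have h2 := (hfrozen t' ht' t ht't.le (by omega) (x t') le_rfl (hEv t' ht'E).2.1.le).mpr hxN'
    exact hout t le_rfl (hσ1 t ht).le h2
  -- (3) every change is charged at most twice
  have hfib : ∀ m ∈ M, (P.filter (fun t => (σ t, ζ t) = m)).card ≤ 2 := by
    intro m _
    set F := P.filter (fun t => (σ t, ζ t) = m) with hF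
    have hFx : ∀ t ∈ F, t ∈ P ∧ σ t = m.1 ∧ ζ t = m.2 ∧ x t ≤ m.2 := by
      intro t ht
      obtain ⟨htP, htm⟩ := mem_filter.mp ht
      have := hζ1 t htP
      rw [← htm]
      exact ⟨htP, rfl, rfl, this⟩
    have hA : (F.filter (fun t => x t < m.2)).card ≤ 1 := by
      refine Finset.card_le_one.mpr (fun t ht t' ht' => ?_)
      obtain ⟨htF, htx⟩ := mem_filter.mp ht
      obtain ⟨ht'F, ht'x⟩ := mem_filter.mp ht'
      obtain ⟨htP, hs, hz, -⟩ := hFx t htF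
      obtain ⟨ht'P, hs', hz', -⟩ := hFx t' ht'F
      by_contra hne
      have hxne : x t ≠ x t' := fun h => hne (hsame t htP t' ht'P h (hs.trans hs'.symm))
      rcases lt_or_gt_of_ne hxne with hlt | hlt
      · exact hlt_false t htP t' ht'P hlt (by rw [hz]; exact ht'x) (hs.trans hs'.symm) (hz.trans hz'.symm)
      · exact hlt_false t' ht'P t htP hlt (by rw [hz']; exact htx) (hs'.trans hs.symm) (hz'.trans hz.symm)
    have hB : (F.filter (fun t => ¬ x t < m.2)).card ≤ 1 := by
      refine Finset.card_le_one.mpr (fun t ht t' ht' => ?_)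
      obtain ⟨htF, htx⟩ := mem_filter.mp ht
      obtain ⟨ht'F, ht'x⟩ := mem_filter.mp ht'
      obtain ⟨htP, hs, -, hle⟩ := hFx t htF
      obtain ⟨ht'P, hs', -, hle'⟩ := hFx t' ht'F
      exact hsame t htP t' ht'P (by omega) (hs.trans hs'.symm)
    have := Finset.card_filter_add_card_filter_not (s := F) (fun t => x t < m.2)
    omega
  have hP_le : P.card ≤ 2 * M.card :=
    Finset.card_le_mul_card_image_of_maps_to (fun t ht => hmaps t ht) 2 hfib
  omega

end GapCharging

end StaticPathFold

end Summit.ValiantsHypothesis.ValiantsHypothesis.Theorems.KPlusLogSqLaw
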